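import Mathlib.Analysis.Complex.Basic
import Mathlib.Algebra.BigOperators.Finprod
import Mathlib.Algebra.Group.Conj
import Mathlib.Order.Filter.Cofinite
import HarnessLib

/-!
# Langlands–Shelstad (1987), §6 «Global consequences» — adelic images, `Δ_𝔸`, and the product formulas as named predicates

R. P. Langlands, D. Shelstad, *On the definition of transfer factors*, Math. Ann. **278** (1987) 219–271
[LanglandsShelstad1987].  PAGE PINS «(p. N)» are the printed Math. Ann. 278 pages, read on the GDZ scan (page texts
`HOME/lit/lit3/g0/texts/LanglandsShelstad1987-GDZ/p0219.txt … p0272.txt` of the HCML cell); the text was READ on the authors'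
re-typeset reissue `paper:doi-10-1007-bf01458070` (58 pp., own pagination 1–58, item numbering identical), §6 = typescript
pp. 51–58 = Math. Ann. pp. 264–271: (6.1) Outline (the `SL(2)` example,
the global matching (6.1.4)); (6.2) Notation; (6.3) Adelic images and transfer factors — `μ_v`, Lemma 6.3.A, (6.3.1),
`d(γ_H, γ_G)`, (6.3.2), Lemma 6.3.B, the definition of `Δ_𝔸`; (6.4) Product formulas — the normalisation of the local
factors `Δ^{(v)}`, Theorem 6.4.A, Corollary 6.4.B.  Squad TN (HCML «GO 500», SPLIT-v1 row TN-t03); topic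
`NumberTheory/Automorphic/LanglandsShelstad1987`, namespace `Literature.NumberTheory.Automorphic.LanglandsShelstad1987.GlobalProductFormula`.
Companion of `…/LanglandsShelstad1987/Properties.lean` (§4), same discipline.  STATEMENTS ONLY: no theorem, no `sorry`,
no axiom, no instance, no notation.

## Standing setting of §6 (pp. 266–268)
`F` a number field, `𝔸` its adèles, `G`, `ψ : G → G*`, `(H, ℋ, s, ξ)` global endoscopic data with `ℋ = ᴸH` («Passage to
the general case is then routine, following (4.4)», p. 266); a finite set `V₀` of places outside which everything is
unramified and `K_v`, `K*_v` hyperspecial (6.2).  (6.3), p. 266: «Suppose `γ_H ∈ H(F)` is `G`-regular and lies in the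
maximal torus `T_H` of `H`.  At each place `v` we shall allow only admissible embeddings of `T_H` in `G*` which are
defined over `F` … Then we say that `γ_H` is an adelic image of `γ_G ∈ G(𝔸)` if, for every `v`, `γ_H` is an image of
the component `γ_{G,v}` of `γ_G` in `G(F_v)`.»  «Suppose `γ_H`, `γ̄_H` are strongly `G`-regular elements of `H(F)` and
are adelic images of `γ_G`, `γ̄_G ∈ G(𝔸)`.»  P. 55: «Fix strongly `G`-regular `γ̄_H ∈ H(F)` and `γ̄_G ∈ G(F)` such that
`γ̄_H` is an adelic image of `γ̄_G`.  We assume that such a pair exists; otherwise all the following factors are to be zero.»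

## How §6 is typed (as in `Properties.lean`: PREDICATES on explicit data; `∀ data, …` is NOT claimed)
The global Tate–Nakayama pairings, the classes `μ_v`, `μ`, `μ_T` and the terms `Δ_I^{(v)}, …` of (6.3)–(6.4) are not
constructible in the tree today, so every numbered item is a `def … : Prop` predicate on the following data (print's
words → parameter), and every object print DEFINES from them is a REAL `def`:
* `V` — the set of places of `F`; «for almost all `v`» = `∀ᶠ v in Filter.cofinite`; «`∏_v`» = Mathlib's `finprod`
  `∏ᶠ v` (the true product once almost all factors are `1`, as items (i) assert; junk `1` otherwise — said where used).
* `A` — the group `H(F)`; `B v` — the group `G(F_v)`; `GA` — the group `G(𝔸)` with its component homomorphisms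
  `comp v : GA →* B v`; `GF` — the group `G(F)` with the diagonal embedding `ρ : GF →* GA`.
* `sregH : A → Prop` — «strongly `G`-regular» (p. 225); `stH : A → A → Prop` — stable conjugacy in `H(F)`;
  `img v : A → B v → Prop` — «`γ_H` is an image of `γ_{G,v}`» over `F_v` ((1.3) p. 226, with embeddings over `F`, p. 266);
  `G(𝔸)`-conjugacy = Mathlib's `IsConj` in `GA`.
* `μ : A → GA → A → GA → (v : V) → M v` — the classes `μ_v = inv(γ_H, γ_{G,v} / γ̄_H, γ̄_{G,v}) ∈ H¹(Γ_v, U(L_v))` of (3.4)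
  (p. 267), in abstract pointed carriers `M v` (`1` = the trivial class).
* `d : A → GA → ℂ` — «`d(γ_H, γ_G)`» `= ⟨μ_T, s_T⟩` (p. 268, global Tate–Nakayama pairing), a bare function.
* `Δloc v : A → B v → ℂ` — the local factor `Δ^{(v)}(γ_H, γ_{G,v})` of (3.7) at `v`, normalised as in (6.4) (p. 268);
  `τ v : A → B v → ℂ` — any one of the four absolute terms `Δ_I^{(v)}, Δ_II^{(v)}, Δ_2^{(v)}, Δ_IV^{(v)}` computed with
  admissible embeddings over `F` and GLOBAL `a`-data and `χ`-data (p. 269: «We shall use embeddings over `F` and global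
  `a`- and `χ`-data [see (2.2), (2.5)] in order to obtain product formulas for the individual terms as well as for `Δ`»);
  `Δ1 v : A → B v → A → B v → ℂ` — the relative term `Δ_1^{(v)}(γ_H, γ_{G,v}; γ̄_H, γ̄_{G,v})`.
* (6.1.4): `ΦstA : A → ℂ` — `γ_H ↦ Φ^{st}_𝔸(γ_H, f^H)` («the sum of the integrals of `f^H` along the `H(𝔸)`-conjugacy
  classes of elements everywhere locally stably conjugate to `γ_H`», p. 266); `ΦA : GA → ℂ` — `γ_G ↦ Φ_𝔸(γ_G, f)`, for a
  FIXED pair `f = ⊗ f_v`, `f^H = ⊗ f^H_v`.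
REAL definitions: `IsAdelicImage` (pp. 266–267), `adelicFactor` (`Δ_𝔸`, p. 268), `IsNormalisedFamily` (the admissible
normalisations of (6.4), p. 268).

## Item ↦ declaration (paper order)
| print | Math. Ann. page | declaration |
|---|---|---|
| (6.3) «`γ_H` is an adelic image of `γ_G ∈ G(𝔸)`» (definition) | pp. 266–267 | `IsAdelicImage` |
| Lemma 6.3.A «`μ_v = 1` for almost all `v`» | p. 267 | `Lemma63AAlmostAllTrivial` |
| Lemma 6.3.B (i), (ii), (iii) | p. 268 | `Lemma63BiStable`, `Lemma63BiiConj`, `Lemma63BiiiRational` |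
| (6.3) Definition of `Δ_𝔸(γ_H, γ_G)` | p. 268 | `adelicFactor` |
| (6.3) «`Δ_𝔸` is independent of (i) the pair `γ̄_H, γ̄_G`; (ii) `γ_H` within its stable class; (iii) `γ_G` within its `G(𝔸)`-class» | p. 268 | `Par63AdelicFactorInvariance` |
| (6.3) «`Δ_𝔸(γ_H, γ_G) = 1` if … the `G(𝔸)`-conjugacy class of `γ_G` meets `G(F)`» | p. 268 | `Par63AdelicFactorEqOne` |
| (6.4) normalisation «`Δ^{(v)}(γ̄_H, γ̄_G) = 1` at almost all `v`, `∏_v Δ^{(v)}(γ̄_H, γ̄_G) = 1`» | p. 268 | `IsNormalisedFamily` |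
| Theorem 6.4.A (i) + (ii), for each of `Δ_I^{(v)}, Δ_II^{(v)}, Δ_2^{(v)}, Δ_IV^{(v)}` | p. 269 | `Thm64ATermProductFormula` |
| (6.4) «`Δ_1^{(v)}(…; γ̄_H, γ̄_G) = 1` for almost all `v`» and «`∏_v Δ_1^{(v)}(…) = Δ_𝔸(γ_H, γ_G)`» | p. 269 | `Par64RelTermProduct` |
| Corollary 6.4.B (i) + (ii) (the product formula; contains the Global Hypothesis of [L2, p. 149]) | p. 269 | `Cor64BProductFormula` |
| (6.1.4) the global matching `Φ^{st}_𝔸(γ_H, f^H) = Σ_{γ_G} Δ_𝔸(γ_H, γ_G) Φ_𝔸(γ_G, f)` (as a relation) | p. 265 | `HasAdelicMatching` |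

DEDUP.  The ≈ 30 tree tags `[cite: LanglandsShelstad1987, §6.4 …]` are PROVENANCE tags on the explicit `U(3)`∕CM-model
statements under `Literature/NumberTheory/Rogawski1990/` — ★ `adelicTransferFactor` (a `finprod` over the finite places),
★ `IsAlmostEverywhereTrivial`, ★ `SatisfiesProductFormula`, ★ `GlobalTransferFactorProductFormula`,
★ `GlobalTransferWithFundamentalLemma` (`GlobalTransferFactor.lean`, `TransferFactsStabilisation.lean`,
`ExplicitFactorGlobalKappaFormula.lean`, …): Rogawski's (4.3.3) for `U(3)`, i.e. Cor. 6.4.B (ii) at RATIONAL pairs where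
`Δ_𝔸 = 1`; they are cited here, not restated.  The abstract statements below are new (`lean search` finds no adelic-image ∕
`Δ_𝔸` vocabulary).

NOT typed here: the proofs; (6.2) (notation only); the displayed local-global identities (6.3.1)
`⟨μ, s_U⟩ = ∏_v ⟨μ_v, s_{U,v}⟩` and (6.3.2) `⟨μ, s_U⟩ = ⟨μ̄_T, s_T̄⟩ / ⟨μ_T, s_T⟩` (steps of the construction of `d`, whose
only printed uses are Lemma 6.3.B and `Par64RelTermProduct`, both typed); the `SL(2)` example of (6.1); the extension of
(6.1.4) to `G`-regular, not strongly `G`-regular `γ_H` («With a little care this extends …», p. 266).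

## References
* [LanglandsShelstad1987] R. P. Langlands, D. Shelstad, *On the definition of transfer factors*, Math. Ann. 278 (1987)
  219–271: §6 = pp. 264–271, with (1.3) pp. 225–226, (3.4) pp. 245–246, (3.7) p. 248 (pins from the GDZ scan texts);
  read on the typescript reissue `paper:doi-10-1007-bf01458070`, §6 = typescript pp. 51–58 (materialised pages p0051–p0058),
  (1.3) = typescript pp. 8–9, (3.4) pp. 30–31, (3.7) p. 34.
* [L2] R. P. Langlands, *Les débuts d'une formule des traces stable*, Publ. Math. Univ. Paris VII 13 (1983) — Lemma 8.3
  and the Global Hypothesis p. 149, cited by print; not used here beyond the names.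
-/

open Filter

namespace Literature.NumberTheory.Automorphic.LanglandsShelstad1987.GlobalProductFormula

/-! ## (6.3) Adelic images and transfer factors (pp. 266–268) -/

section AdelicImages

variable {V A GA GF : Type*} {B : V → Type*} [Group A] [Group GA] [Group GF] [∀ v, Group (B v)]

/-- **[LanglandsShelstad1987, (6.3) (pp. 266–267)]**, definition: «we say that `γ_H` is an adelic image of
`γ_G ∈ G(𝔸)` if, for every `v`, `γ_H` is an image of the component `γ_{G,v}` of `γ_G` in `G(F_v)`» (with admissible
embeddings over `F` only, p. 266).  Data: `img v` = «is an image of» over `F_v`, `comp v : GA →* B v` the component map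
`G(𝔸) → G(F_v)`.  REAL definition. [cite: LanglandsShelstad1987, §6.3 (pp. 266–267)] -/
def IsAdelicImage (img : ∀ v, A → B v → Prop) (comp : ∀ v, GA →* B v) (a : A) (g : GA) : Prop :=
  ∀ v, img v a (comp v g)

/-- **[LanglandsShelstad1987, Lemma 6.3.A (p. 267)]**: for strongly `G`-regular `γ_H, γ̄_H ∈ H(F)` that are
adelic images of `γ_G, γ̄_G ∈ G(𝔸)` and the classes `μ_v = inv(γ_H, γ_{G,v} / γ̄_H, γ̄_{G,v}) ∈ H¹(Γ_v, U(L_v))` of (3.4):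
«`μ_v = 1` for almost all `v`.»  Data: `μ a g a₀ g₀ v : M v` the class at `v` in an abstract pointed carrier (`1` = trivial
class).  Typed: under the four standing hypotheses, `∀ᶠ v in cofinite, μ a g a₀ g₀ v = 1`.
[cite: LanglandsShelstad1987, Lemma 6.3.A (p. 267)] -/
def Lemma63AAlmostAllTrivial {M : V → Type*} [∀ v, One (M v)] (sregH : A → Prop) (img : ∀ v, A → B v → Prop)
    (comp : ∀ v, GA →* B v) (μ : A → GA → A → GA → ∀ v, M v) : Prop :=
  ∀ ⦃a : A⦄ ⦃g : GA⦄ ⦃a' : A⦄ ⦃g' : GA⦄, sregH a → IsAdelicImage img comp a g → sregH a' →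
    IsAdelicImage img comp a' g' → ∀ᶠ v in cofinite, μ a g a' g' v = 1

/-- **[LanglandsShelstad1987, Lemma 6.3.B (i) (p. 268)]**, for `d(γ_H, γ_G) = ⟨μ_T, s_T⟩` (p. 268; defined for
strongly `G`-regular `γ_H ∈ H(F)` an adelic image of `γ_G ∈ G(𝔸)`): «`d(γ′_H, γ_G) = d(γ_H, γ_G)` if `γ′_H` is stably
conjugate to `γ_H` in `H(F)`.»  Typed: `sregH a → IsAdelicImage … a g → stH a a′ → d a′ g = d a g`.
[cite: LanglandsShelstad1987, Lemma 6.3.B (i) (p. 268)] -/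
def Lemma63BiStable (sregH : A → Prop) (stH : A → A → Prop) (img : ∀ v, A → B v → Prop) (comp : ∀ v, GA →* B v)
    (d : A → GA → ℂ) : Prop :=
  ∀ ⦃a a' : A⦄ ⦃g : GA⦄, sregH a → IsAdelicImage img comp a g → stH a a' → d a' g = d a g

/-- **[LanglandsShelstad1987, Lemma 6.3.B (ii) (p. 268)]**: «`d(γ_H, γ′_G) = d(γ_H, γ_G)` if `γ′_G` is
`G(𝔸)`-conjugate to `γ_G`.»  `G(𝔸)`-conjugacy = Mathlib's `IsConj` in `GA`.  Typed:
`sregH a → IsAdelicImage … a g → IsConj g g′ → d a g′ = d a g`. [cite: LanglandsShelstad1987, Lemma 6.3.B (ii) (p. 268)] -/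
def Lemma63BiiConj (sregH : A → Prop) (img : ∀ v, A → B v → Prop) (comp : ∀ v, GA →* B v) (d : A → GA → ℂ) :
    Prop :=
  ∀ ⦃a : A⦄ ⦃g g' : GA⦄, sregH a → IsAdelicImage img comp a g → IsConj g g' → d a g' = d a g

/-- **[LanglandsShelstad1987, Lemma 6.3.B (iii) (p. 268)]**: «`d(γ_H, γ_G) = d(γ̄_H, γ̄_G)` if `γ_H`, `γ̄_H` are
adelic images of `γ_G, γ̄_G ∈ G(F)`.»  Data: `ρ : GF →* GA` the diagonal embedding `G(F) → G(𝔸)`.  Typed: for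
`q, q₀ : GF`, `sregH a → IsAdelicImage … a (ρ q) → sregH a₀ → IsAdelicImage … a₀ (ρ q₀) → d a (ρ q) = d a₀ (ρ q₀)`.
[cite: LanglandsShelstad1987, Lemma 6.3.B (iii) (p. 268)] -/
def Lemma63BiiiRational (sregH : A → Prop) (img : ∀ v, A → B v → Prop) (comp : ∀ v, GA →* B v) (ρ : GF →* GA)
    (d : A → GA → ℂ) : Prop :=
  ∀ ⦃a a' : A⦄ ⦃q q' : GF⦄, sregH a → IsAdelicImage img comp a (ρ q) → sregH a' →
    IsAdelicImage img comp a' (ρ q') → d a (ρ q) = d a' (ρ q')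

/-- **[LanglandsShelstad1987, (6.3) Definition (p. 268)]**: with a FIXED base pair — «strongly `G`-regular
`γ̄_H ∈ H(F)` and `γ̄_G ∈ G(F)` such that `γ̄_H` is an adelic image of `γ̄_G`» — «For all strongly `G`-regular
`γ_H ∈ H(F)`, `Δ_𝔸(γ_H, γ_G) = d(γ̄_H, γ̄_G) / d(γ_H, γ_G)` if `γ_H` is an adelic image of `γ_G ∈ G(𝔸)` and
`Δ_𝔸(γ_H, γ_G) = 0` otherwise.»  Data: `d`, `img`, `comp` as above; the base pair `(a₀, g₀)` with `g₀ : GA` (print: `g₀ = ρ q₀`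
rational — the predicates below supply it in that form).  REAL definition (a classical `ite` on `IsAdelicImage`; Mathlib
division on `ℂ`). [cite: LanglandsShelstad1987, §6.3 (p. 268)] -/
noncomputable def adelicFactor (d : A → GA → ℂ) (img : ∀ v, A → B v → Prop) (comp : ∀ v, GA →* B v) (a₀ : A)
    (g₀ : GA) (a : A) (g : GA) : ℂ :=
  @ite ℂ (IsAdelicImage img comp a g) (Classical.dec _) (d a₀ g₀ / d a g) 0

/-- **[LanglandsShelstad1987, (6.3) (p. 268)]**: «By Lemma 6.[3].B, `Δ_𝔸(γ_H, γ_G)` is independent of: (i) the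
pair `γ̄_H, γ̄_G`; (ii) `γ_H` within its stable conjugacy class; (iii) `γ_G` within its `G(𝔸)`-conjugacy class» (print
writes «Lemma 6.4.B»; the lemma meant is 6.3.B).  Typed as three clauses about `adelicFactor`, for admissible base pairs
(`sregH a₀`, `a₀` an adelic image of `ρ q₀`, `q₀ ∈ G(F)`) and strongly `G`-regular `γ_H`: (i) two admissible base pairs give
the same value; (ii) `stH a a′ →` same value; (iii) `IsConj g g′ →` same value.
[cite: LanglandsShelstad1987, §6.3 (p. 268)] -/
def Par63AdelicFactorInvariance (sregH : A → Prop) (stH : A → A → Prop) (img : ∀ v, A → B v → Prop)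
    (comp : ∀ v, GA →* B v) (ρ : GF →* GA) (d : A → GA → ℂ) : Prop :=
  (∀ ⦃a₀ a₀' : A⦄ ⦃q₀ q₀' : GF⦄ ⦃a : A⦄ (g : GA), sregH a₀ → IsAdelicImage img comp a₀ (ρ q₀) → sregH a₀' →
      IsAdelicImage img comp a₀' (ρ q₀') → sregH a →
        adelicFactor d img comp a₀ (ρ q₀) a g = adelicFactor d img comp a₀' (ρ q₀') a g) ∧
    (∀ ⦃a₀ : A⦄ ⦃q₀ : GF⦄ ⦃a a' : A⦄ (g : GA), sregH a₀ → IsAdelicImage img comp a₀ (ρ q₀) → sregH a → stH a a' →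
        adelicFactor d img comp a₀ (ρ q₀) a' g = adelicFactor d img comp a₀ (ρ q₀) a g) ∧
      ∀ ⦃a₀ : A⦄ ⦃q₀ : GF⦄ ⦃a : A⦄ ⦃g g' : GA⦄, sregH a₀ → IsAdelicImage img comp a₀ (ρ q₀) → sregH a → IsConj g g' →
        adelicFactor d img comp a₀ (ρ q₀) a g' = adelicFactor d img comp a₀ (ρ q₀) a g

/-- **[LanglandsShelstad1987, (6.3) (p. 268)]**: «Further, `Δ_𝔸(γ_H, γ_G) = 1` if `γ_H` is an adelic image of
`γ_G` and the `G(𝔸)`-conjugacy class of `γ_G` meets `G(F)`.»  Typed, for an admissible base pair `(a₀, ρ q₀)` and strongly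
`G`-regular `γ_H`: `IsAdelicImage … a g → (∃ q : GF, IsConj g (ρ q)) → adelicFactor … a g = 1`.
[cite: LanglandsShelstad1987, §6.3 (p. 268)] -/
def Par63AdelicFactorEqOne (sregH : A → Prop) (img : ∀ v, A → B v → Prop) (comp : ∀ v, GA →* B v) (ρ : GF →* GA)
    (d : A → GA → ℂ) : Prop :=
  ∀ ⦃a₀ : A⦄ ⦃q₀ : GF⦄ ⦃a : A⦄ ⦃g : GA⦄, sregH a₀ → IsAdelicImage img comp a₀ (ρ q₀) → sregH a →
    IsAdelicImage img comp a g → (∃ q : GF, IsConj g (ρ q)) → adelicFactor d img comp a₀ (ρ q₀) a g = 1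

end AdelicImages

/-! ## (6.4) Product formulas (pp. 268–271) -/

section ProductFormulas

variable {V A GA GF : Type*} {B : V → Type*} [Group A] [Group GA] [Group GF] [∀ v, Group (B v)]

/-- **[LanglandsShelstad1987, (6.4) (p. 268)]**, the admissible normalisations of the local factors: «To specify
the local factors of (3.7) we use a pair `γ̄_H, γ̄_G` of `F`-rational elements, as for the adelic factor.  At almost all
places `v` we set `Δ^{(v)}(γ̄_H, γ̄_G) = 1`.  At the remaining places `Δ^{(v)}(γ̄_H, γ̄_G)` is arbitrary except for the
requirement that `∏_v Δ^{(v)}(γ̄_H, γ̄_G) = 1`.»  Data: `Δloc v : A → B v → ℂ` the family of local factors, the base pair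
`(a₀, g₀)` with `g₀ : GA` (print: `g₀ = ρ q₀`).  REAL definition: almost all base values are `1` and their `finprod` (then the
true finite product) is `1`. [cite: LanglandsShelstad1987, §6.4 (p. 268)] -/
def IsNormalisedFamily (Δloc : ∀ v, A → B v → ℂ) (comp : ∀ v, GA →* B v) (a₀ : A) (g₀ : GA) : Prop :=
  (∀ᶠ v in cofinite, Δloc v a₀ (comp v g₀) = 1) ∧ ∏ᶠ v, Δloc v a₀ (comp v g₀) = 1

/-- **[LanglandsShelstad1987, Theorem 6.4.A (p. 269)]**: «(i) For almost all `v` each of `Δ_I^{(v)}(γ_H, γ_{G,v})`,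
`Δ_II^{(v)}(γ_H, γ_{G,v})`, `Δ_2^{(v)}(γ_H, γ_{G,v})` and `Δ_IV^{(v)}(γ_H, γ_{G,v})` equals `1`.
(ii) `∏_v Δ_I^{(v)}(γ_H, γ_{G,v}) = 1`, and similarly for `Δ_II^{(v)}`, `Δ_2^{(v)}`, and `Δ_IV^{(v)}`» — for strongly
`G`-regular `γ_H ∈ H(F)` an adelic image of `γ_G ∈ G(𝔸)` (6.3), the terms being computed with admissible embeddings OVER
`F` and GLOBAL `a`-data and `χ`-data (p. 269; with merely local auxiliary data the individual products need not be `1`).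
Typed ONCE for a family `τ v : A → B v → ℂ` standing for any one of the four terms; print's theorem is the conjunction of
the four instances.  `∏ᶠ` is the true product by (i). [cite: LanglandsShelstad1987, Theorem 6.4.A (p. 269)] -/
def Thm64ATermProductFormula (sregH : A → Prop) (img : ∀ v, A → B v → Prop) (comp : ∀ v, GA →* B v)
    (τ : ∀ v, A → B v → ℂ) : Prop :=
  ∀ ⦃a : A⦄ ⦃g : GA⦄, sregH a → IsAdelicImage img comp a g →
    (∀ᶠ v in cofinite, τ v a (comp v g) = 1) ∧ ∏ᶠ v, τ v a (comp v g) = 1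

/-- **[LanglandsShelstad1987, (6.4) (p. 269)]**, the relative term: «In the last section we showed that
`Δ_1^{(v)}(γ_H, γ_{G,v}; γ̄_H, γ̄_G) = 1` for almost all `v` (Lemma 6.3.A) and that
`∏_v Δ_1^{(v)}(γ_H, γ_{G,v}; γ̄_H, γ̄_G) = Δ_𝔸(γ_H, γ_G)` [(6.3.1) and (6.3.2)].»  Data: `Δ1 v a g_v a₀ g₀_v` the term
`Δ_1^{(v)} = Δ_{III₁}^{(v)}` of (3.4) at `v`; base pair `(a₀, ρ q₀)` admissible; `γ_H` strongly `G`-regular adelic image of `γ_G`.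
[cite: LanglandsShelstad1987, §6.4 (p. 269)] -/
def Par64RelTermProduct (sregH : A → Prop) (img : ∀ v, A → B v → Prop) (comp : ∀ v, GA →* B v) (ρ : GF →* GA)
    (d : A → GA → ℂ) (Δ1 : ∀ v, A → B v → A → B v → ℂ) : Prop :=
  ∀ ⦃a₀ : A⦄ ⦃q₀ : GF⦄ ⦃a : A⦄ ⦃g : GA⦄, sregH a₀ → IsAdelicImage img comp a₀ (ρ q₀) → sregH a →
    IsAdelicImage img comp a g →
      (∀ᶠ v in cofinite, Δ1 v a (comp v g) a₀ (comp v (ρ q₀)) = 1) ∧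
        ∏ᶠ v, Δ1 v a (comp v g) a₀ (comp v (ρ q₀)) = adelicFactor d img comp a₀ (ρ q₀) a g

/-- **[LanglandsShelstad1987, Corollary 6.4.B (p. 269)]**: «(i) `Δ^{(v)}(γ_H, γ_{G,v}) = 1` for almost all `v` and
(ii) `∏_v Δ^{(v)}(γ_H, γ_{G,v}) = Δ_𝔸(γ_H, γ_G)`.  This product formula contains the Global Hypothesis of [L2, p. 149]
because `Δ_𝔸(γ_H, γ_G)` is the term `κ(𝔡(D))` of [L2].»  Data: `Δloc` the family of local factors of (3.7) normalised at
the admissible base pair `(a₀, ρ q₀)` (`IsNormalisedFamily`, an antecedent), `γ_H ∈ H(F)` strongly `G`-regular and an adelic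
image of `γ_G ∈ G(𝔸)` (standing hypothesis of (6.3); when `γ_H` is NOT an adelic image both sides of (ii) vanish in print —
`Δ_𝔸 = 0` by definition and some local factor is `0` — a case not asserted here).  `∏ᶠ` is the true product by (i).
See also, for `G = U(3)` over a CM field: ★ `Literature.NumberTheory.Rogawski1990.IsAlmostEverywhereTrivial`,
★ `…SatisfiesProductFormula`, ★ `…GlobalTransferFactorProductFormula` ([Rogawski1990, (4.3.3)] — (ii) at rational pairs,
where `Δ_𝔸 = 1`). [cite: LanglandsShelstad1987, Corollary 6.4.B (p. 269)] -/
def Cor64BProductFormula (sregH : A → Prop) (img : ∀ v, A → B v → Prop) (comp : ∀ v, GA →* B v) (ρ : GF →* GA)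
    (d : A → GA → ℂ) (Δloc : ∀ v, A → B v → ℂ) : Prop :=
  ∀ ⦃a₀ : A⦄ ⦃q₀ : GF⦄ ⦃a : A⦄ ⦃g : GA⦄, sregH a₀ → IsAdelicImage img comp a₀ (ρ q₀) →
    IsNormalisedFamily Δloc comp a₀ (ρ q₀) → sregH a → IsAdelicImage img comp a g →
      (∀ᶠ v in cofinite, Δloc v a (comp v g) = 1) ∧
        ∏ᶠ v, Δloc v a (comp v g) = adelicFactor d img comp a₀ (ρ q₀) a g

end ProductFormulas

/-! ## (6.1.4) The global matching of orbital integrals, as a relation (pp. 265–266) -/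

section GlobalMatching

variable {A GA : Type*} [Group A] [Group GA]

/-- **[LanglandsShelstad1987, (6.1.4) (pp. 265–266)]**: «Thus if `f_v` and `f_v^H` have `Δ`-matching orbital integrals
for all `v` we conclude that `Φ^{st}_𝔸(γ_H, f^H) = Σ_{γ_G} Δ_𝔸(γ_H, γ_G) Φ_𝔸(γ_G, f)`, where the left side is, by
definition, the sum of the integrals of `f^H` along the `H(𝔸)`-conjugacy classes of elements everywhere locally stably
conjugate to `γ_H`» — for strongly `G`-regular `γ_H ∈ H(F)`, the sum over representatives `γ_G` of `G(𝔸)`-conjugacy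
classes (p. 264, (6.1.1)).  Typed as the RELATION «`f`, `f^H` have `Δ_𝔸`-matching adelic orbital integrals» between the
functions `ΦstA : A → ℂ` (`γ_H ↦ Φ^{st}_𝔸(γ_H, f^H)`), `ΦA : GA → ℂ` (`γ_G ↦ Φ_𝔸(γ_G, f)`) and an adelic factor
`ΔA : A → GA → ℂ` (e.g. `adelicFactor …`): for every strongly `G`-regular `γ_H`,
`ΦstA γ_H = ∑ᶠ_{[γ_G] ∈ ConjClasses G(𝔸)} ΔA γ_H γ_G * ΦA γ_G` (a `finsum` over classes through `Quotient.out`; print: only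
finitely many nonzero terms).  Print's sentence is the implication «local `Δ`-matching at every `v` ⟹ this relation for
`ΔA = Δ_𝔸`», via (6.1.2)–(6.1.3) = Cor. 6.4.B and [L2, Lemma 8.3]; the local relation is ★
`Literature.NumberTheory.Rogawski1990.IsDeltaTransferRel` in the tree's currency. [cite: LanglandsShelstad1987, §6.1 (6.1.4) (pp. 265–266)] -/
def HasAdelicMatching (sregH : A → Prop) (ΔA : A → GA → ℂ) (ΦstA : A → ℂ) (ΦA : GA → ℂ) : Prop :=
  ∀ ⦃a : A⦄, sregH a → ΦstA a = ∑ᶠ c : ConjClasses GA, ΔA a (Quotient.out c) * ΦA (Quotient.out c)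

end GlobalMatching

end Literature.NumberTheory.Automorphic.LanglandsShelstad1987.GlobalProductFormula
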